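import Summits.Ventures.CertifiedArithmetic.LowPrec.ScaleInvariance

/-!
# Significand-level error formulas, grid level (THEOREMS-R1, Theorem E5, closed form — part 1)

HONEST FRAMING (venture CertifiedArithmetic / cell `pub-lowprec`): certified error envelopes and
provably optimal rounding/accumulation schemes for low-precision formats under stated cost models;
every table by two implementations; no hardware or vendor claims.

Theorem E5 of `THEOREMS-R1.md` (sec. 3) reduces every normal-band envelope constant of an
operation table (maximum relative error, maximum error in ulps; `ENVELOPES.md`) to a maximum over
integer SIGNIFICAND PATTERNS: a `P+k`-bit pattern `n` (`2^(m+k) ≤ n < 2^(m+k+1)`, `P = m + 1` the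
precision of the destination `φ`) placed in the binade of spacing `2^s` is rounded with error
`err(n) · 2^s / 2^k`, where with `rem = n mod 2^k`: `err = min(rem, 2^k - rem)` to nearest, `rem`
toward zero, `2^k - rem` (or `0` when `rem = 0`) away from zero. This file proves these formulas
for EVERY format on the magnitude grid in quanta (`Format.rneGrid` / `rdGrid` / `ruGrid` of
`RoundGrid.lean` / `Directed.lean`): for `r = n · 2^s / 2^k ≤ maxScaled` the binade of `r` has
shift `s`, the top binade included (`Format.shift_floor_of_pattern`; no clamping ever occurs since
`maxScaled` is a grid point, `Format.rneMult_le_maxScaled_of_le`), and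
`rneGrid r = rneInt (n / 2^k) · 2^s`, `rdGrid r = (n / 2^k)_ℕ · 2^s`, `ruGrid r = ⌈n / 2^k⌉ · 2^s`
(`Format.rneGrid_of_pattern`, `rdGrid_of_pattern`, `ruGrid_of_pattern`) with the three error
formulas `Format.abs_sub_rneGrid_of_pattern`, `sub_rdGrid_of_pattern`, `ruGrid_sub_of_pattern`.
The integer level underneath is the nearest-integer error of `n / 2^k` in closed form
(`abs_sub_rneInt_natCast_div_two_pow`: `min(rem, 2^k - rem) / 2^k`, ties included). The value level
(`roundNE`, `roundTowardZero`, `roundDown`, `roundUp`; relative and ulp errors as functions of the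
pattern alone; exactness iff `2^k ∣ n`) is `SignificandErrorValue.lean`. These are the formulas the
pattern enumerator `code/enum/envconst.py` evaluates behind the pre-registered constants
`certs/enum/PREDICTIONS-ENVCONST*.json`; the doubling form `fl(2^j x) = 2^j fl(x)` of the same
invariance is `ScaleInvariance.lean`.

Placement: venture development under `Summits/Ventures/CertifiedArithmetic/`; declarations are
dot-notation extensions of the Literature structure `Format` and carry their absolute
`Literature.ComputerArithmetic.FloatingPoint.…` names (CONVENTIONS §2). New work of the venture
(elementary; [folklore] tags mark statements any numerical analyst would recognise: the error of
rounding a `P+k`-bit integer to `P` bits, cf. [cite: Higham2002ASNA, §2.1]; Knuth, TAOCP vol. 2,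
§4.2.2).
-/

namespace Literature.ComputerArithmetic.FloatingPoint

/-! ### Integer level: rounding `n / 2^k` to an integer -/

/-- Euclidean decomposition through the cast: `n / 2^k = (n / 2^k)_ℕ + (n mod 2^k) / 2^k`.
[folklore] -/
theorem natCast_div_two_pow (n k : ℕ) :
    (n : ℚ) / 2 ^ k = ((n / 2 ^ k : ℕ) : ℚ) + ((n % 2 ^ k : ℕ) : ℚ) / 2 ^ k := by
  have hD : (0 : ℚ) < 2 ^ k := by positivity
  have h : ((2 ^ k * (n / 2 ^ k) + n % 2 ^ k : ℕ) : ℚ) = n := by rw [Nat.div_add_mod]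
  push_cast at h
  field_simp
  linarith

/-- `⌊n / 2^k⌋` is the quotient of `ℕ`. [folklore] -/
theorem floor_natCast_div_two_pow (n k : ℕ) : ⌊(n : ℚ) / 2 ^ k⌋ = ((n / 2 ^ k : ℕ) : ℤ) := by
  have hD : (0 : ℚ) < 2 ^ k := by positivity
  have hρ : ((n % 2 ^ k : ℕ) : ℚ) < 2 ^ k := by exact_mod_cast Nat.mod_lt n (Nat.two_pow_pos k)
  have h0 : (0 : ℚ) ≤ ((n % 2 ^ k : ℕ) : ℚ) / 2 ^ k := by positivity
  have h1 : ((n % 2 ^ k : ℕ) : ℚ) / 2 ^ k < 1 := by rw [div_lt_one hD]; exact hρ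
  rw [Int.floor_eq_iff, natCast_div_two_pow n k]
  simp only [Int.cast_natCast]
  constructor <;> linarith

/-- `⌈n / 2^k⌉ = (n / 2^k)_ℕ + [n mod 2^k ≠ 0]`. [folklore] -/
theorem ceil_natCast_div_two_pow (n k : ℕ) :
    ⌈(n : ℚ) / 2 ^ k⌉ = ((n / 2 ^ k : ℕ) : ℤ) + if n % 2 ^ k = 0 then 0 else 1 := by
  have hD : (0 : ℚ) < 2 ^ k := by positivity
  have hρ : ((n % 2 ^ k : ℕ) : ℚ) < 2 ^ k := by exact_mod_cast Nat.mod_lt n (Nat.two_pow_pos k)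
  rw [Int.ceil_eq_iff, natCast_div_two_pow n k]
  split_ifs with h0
  · rw [h0]
    simp only [Int.cast_natCast, Nat.cast_zero, zero_div, add_zero]
    constructor <;> linarith
  · have h1 : (0 : ℚ) < ((n % 2 ^ k : ℕ) : ℚ) / 2 ^ k :=
      div_pos (by exact_mod_cast Nat.pos_of_ne_zero h0) hD
    have h2 : ((n % 2 ^ k : ℕ) : ℚ) / 2 ^ k ≤ 1 := by rw [div_le_one hD]; exact hρ.le
    simp only [Int.cast_add, Int.cast_natCast, Int.cast_one]
    constructor <;> linarith

/-- NEAREST-INTEGER ERROR OF `n / 2^k` IN CLOSED FORM: `|n/2^k - rneInt (n/2^k)| =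
min(rem, 2^k - rem) / 2^k`, `rem = n mod 2^k` (at a tie both candidates are at distance `1/2`, so
the parity rule does not enter the error). [folklore] -/
theorem abs_sub_rneInt_natCast_div_two_pow (n k : ℕ) :
    |(n : ℚ) / 2 ^ k - (rneInt ((n : ℚ) / 2 ^ k) : ℚ)|
      = ((min (n % 2 ^ k) (2 ^ k - n % 2 ^ k) : ℕ) : ℚ) / 2 ^ k := by
  have hD : (0 : ℚ) < 2 ^ k := by positivity
  have hdec := natCast_div_two_pow n k
  have hfl := floor_natCast_div_two_pow n k
  have hρ : n % 2 ^ k < 2 ^ k := Nat.mod_lt n (Nat.two_pow_pos k)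
  have hhalf := abs_sub_rneInt_le_half ((n : ℚ) / 2 ^ k)
  rcases rneInt_eq_floor_or ((n : ℚ) / 2 ^ k) with h | h <;> rw [h, hfl] at hhalf ⊢
  · have e : (n : ℚ) / 2 ^ k - (((n / 2 ^ k : ℕ) : ℤ) : ℚ) = ((n % 2 ^ k : ℕ) : ℚ) / 2 ^ k := by
      rw [hdec, Int.cast_natCast]; ring
    rw [e, abs_of_nonneg (by positivity)] at hhalf ⊢
    have h2 : 2 * (n % 2 ^ k) ≤ 2 ^ k := by
      rw [div_le_iff₀ hD] at hhalf
      have : (2 : ℚ) * ((n % 2 ^ k : ℕ) : ℚ) ≤ 2 ^ k := by linarith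
      exact_mod_cast this
    rw [Nat.min_eq_left (by omega)]
  · have e : (n : ℚ) / 2 ^ k - ((((n / 2 ^ k : ℕ) : ℤ) + 1 : ℤ) : ℚ)
        = -(((2 ^ k - n % 2 ^ k : ℕ) : ℚ) / 2 ^ k) := by
      rw [hdec, Int.cast_add, Int.cast_natCast, Int.cast_one, Nat.cast_sub hρ.le, Nat.cast_pow,
        Nat.cast_ofNat]
      field_simp
      ring
    rw [e, abs_neg, abs_of_nonneg (by positivity)] at hhalf ⊢
    have h2 : 2 * (2 ^ k - n % 2 ^ k) ≤ 2 ^ k := by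
      rw [div_le_iff₀ hD] at hhalf
      have : (2 : ℚ) * ((2 ^ k - n % 2 ^ k : ℕ) : ℚ) ≤ 2 ^ k := by linarith
      exact_mod_cast this
    rw [Nat.min_eq_right (by omega)]

/-- The nearest error numerator vanishes iff the pattern is divisible: `min(rem, 2^k - rem) = 0 ↔
2^k ∣ n`. [folklore] -/
theorem min_mod_two_pow_eq_zero_iff (n k : ℕ) :
    min (n % 2 ^ k) (2 ^ k - n % 2 ^ k) = 0 ↔ 2 ^ k ∣ n := by
  have hρ : n % 2 ^ k < 2 ^ k := Nat.mod_lt n (Nat.two_pow_pos k)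
  constructor
  · intro h; exact Nat.dvd_of_mod_eq_zero (by omega)
  · intro h; have := Nat.mod_eq_zero_of_dvd h; omega

namespace Format

variable {φ : Format}

/-! ### Grid level: the pattern magnitude `r = n · 2^s / 2^k` -/

/-- From `N ≤ r` to `N ≤ ⌊r⌋`. [folklore] -/
theorem le_floor_toNat_of_natCast_le {r : ℚ} {N : ℕ} (h : (N : ℚ) ≤ r) : N ≤ ⌊r⌋.toNat := by
  have : (N : ℤ) ≤ ⌊r⌋ := Int.le_floor.mpr (by exact_mod_cast h)
  omega

/-- From `0 ≤ r < N` to `⌊r⌋ < N`. [folklore] -/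
theorem floor_toNat_lt_of_lt_natCast {r : ℚ} (hr : 0 ≤ r) {N : ℕ} (h : r < (N : ℚ)) :
    ⌊r⌋.toNat < N := by
  have h1 : ⌊r⌋ < (N : ℤ) := Int.floor_lt.mpr (by exact_mod_cast h)
  have h0 : 0 ≤ ⌊r⌋ := Int.floor_nonneg.mpr hr
  omega

/-- A binade that fits below `maxScaled` is not above the top one: `2^(m+s) ≤ maxScaled` forces
`s ≤ emaxCode - 1` (and `1 ≤ emaxCode`). [folklore] -/
theorem le_emaxCode_sub_one_of_pow_le {s : ℕ} (h : 2 ^ (φ.manBits + s) ≤ φ.maxScaled) :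
    s ≤ φ.emaxCode - 1 := by
  have hm : 2 ^ φ.manBits ≤ 2 ^ (φ.manBits + s) := Nat.pow_le_pow_right (by norm_num) (by omega)
  have hE : 1 ≤ φ.emaxCode := by
    by_contra h0
    have hM := maxScaled_eq_topMan (φ := φ) (by omega)
    have ht := φ.topMan_lt
    omega
  have h2 := maxScaled_lt_pow (φ := φ) hE
  by_contra hlt
  have h4 : 2 ^ (φ.manBits + φ.emaxCode) ≤ 2 ^ (φ.manBits + s) :=
    Nat.pow_le_pow_right (by norm_num) (by omega)
  omega

/-- PATTERN BINADE: for a `P+k`-bit pattern `n` (`2^(m+k) ≤ n < 2^(m+k+1)`) the magnitude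
`r = n · 2^s / 2^k` has `2^(m+s) ≤ ⌊r⌋ < 2^(m+1+s)`. [folklore] -/
theorem floor_toNat_of_pattern {n k s : ℕ} (hlo : 2 ^ (φ.manBits + k) ≤ n)
    (hhi : n < 2 ^ (φ.manBits + k + 1)) :
    2 ^ (φ.manBits + s) ≤ ⌊(n : ℚ) * 2 ^ s / 2 ^ k⌋.toNat ∧
      ⌊(n : ℚ) * 2 ^ s / 2 ^ k⌋.toNat < 2 ^ (φ.manBits + 1 + s) := by
  have hD : (0 : ℚ) < 2 ^ k := by positivity
  have hr : (0 : ℚ) ≤ (n : ℚ) * 2 ^ s / 2 ^ k := by positivity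
  have hloQ : (2 : ℚ) ^ (φ.manBits + k) ≤ n := by exact_mod_cast hlo
  have hhiQ : (n : ℚ) < 2 ^ (φ.manBits + k + 1) := by exact_mod_cast hhi
  constructor
  · apply le_floor_toNat_of_natCast_le
    push_cast
    rw [le_div_iff₀ hD]
    calc (2 : ℚ) ^ (φ.manBits + s) * 2 ^ k = 2 ^ (φ.manBits + k) * 2 ^ s := by ring
      _ ≤ (n : ℚ) * 2 ^ s := mul_le_mul_of_nonneg_right hloQ (by positivity)
  · apply floor_toNat_lt_of_lt_natCast hr
    push_cast
    rw [div_lt_iff₀ hD]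
    calc (n : ℚ) * 2 ^ s < 2 ^ (φ.manBits + k + 1) * 2 ^ s :=
          mul_lt_mul_of_pos_right hhiQ (by positivity)
      _ = 2 ^ (φ.manBits + 1 + s) * 2 ^ k := by ring

/-- An in-range pattern sits in a binade `s ≤ emaxCode - 1`. [folklore] -/
theorem le_emaxCode_sub_one_of_pattern {n k s : ℕ} (hlo : 2 ^ (φ.manBits + k) ≤ n)
    (hhi : n < 2 ^ (φ.manBits + k + 1)) (hle : (n : ℚ) * 2 ^ s / 2 ^ k ≤ φ.maxScaled) :
    s ≤ φ.emaxCode - 1 := by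
  have h1 := (floor_toNat_of_pattern (φ := φ) (s := s) hlo hhi).1
  have hr : (0 : ℚ) ≤ (n : ℚ) * 2 ^ s / 2 ^ k := by positivity
  have h2 : ((⌊(n : ℚ) * 2 ^ s / 2 ^ k⌋.toNat : ℕ) : ℚ) ≤ φ.maxScaled :=
    le_trans (floor_toNat_le hr) hle
  exact le_emaxCode_sub_one_of_pow_le (le_trans h1 (by exact_mod_cast h2))

/-- PATTERN SHIFT: the local spacing exponent at `r = n · 2^s / 2^k ≤ maxScaled` is `s`, the top
binade included. [folklore] -/
theorem shift_floor_of_pattern {n k s : ℕ} (hlo : 2 ^ (φ.manBits + k) ≤ n)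
    (hhi : n < 2 ^ (φ.manBits + k + 1)) (hle : (n : ℚ) * 2 ^ s / 2 ^ k ≤ φ.maxScaled) :
    φ.shift ⌊(n : ℚ) * 2 ^ s / 2 ^ k⌋.toNat = s := by
  obtain ⟨h1, h2⟩ := floor_toNat_of_pattern (φ := φ) (s := s) hlo hhi
  exact MiniFloat.shift_eq_of_bounds h1 h2 (le_emaxCode_sub_one_of_pattern hlo hhi hle)

/-- The scaled quotient of a pattern magnitude: `(n · 2^s / 2^k) / 2^s = n / 2^k`. [folklore] -/
theorem pattern_div_two_pow (n k s : ℕ) :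
    (n : ℚ) * 2 ^ s / 2 ^ k / 2 ^ s = (n : ℚ) / 2 ^ k := by
  have h2s : (2 : ℚ) ^ s ≠ 0 := by positivity
  rw [mul_div_right_comm, mul_div_cancel_right₀ _ h2s]

/-- RNE OF A PATTERN on the grid: `rneGrid (n · 2^s / 2^k) = rneInt (n / 2^k) · 2^s` — round the
pattern to `P` bits, then scale; no clamping occurs, even in the top binade. [folklore] -/
theorem rneGrid_of_pattern {n k s : ℕ} (hlo : 2 ^ (φ.manBits + k) ≤ n)
    (hhi : n < 2 ^ (φ.manBits + k + 1)) (hle : (n : ℚ) * 2 ^ s / 2 ^ k ≤ φ.maxScaled) :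
    (φ.rneGrid ((n : ℚ) * 2 ^ s / 2 ^ k) : ℚ) = (rneInt ((n : ℚ) / 2 ^ k) : ℚ) * 2 ^ s := by
  have hr : (0 : ℚ) ≤ (n : ℚ) * 2 ^ s / 2 ^ k := by positivity
  rw [rneGrid_eq_min, min_eq_left (rneMult_le_maxScaled_of_le hr hle), rneMult_cast hr,
    shift_floor_of_pattern hlo hhi hle, pattern_div_two_pow]

/-- NEAREST, SIGNIFICAND LEVEL (grid): `|r - rneGrid r| = min(rem, 2^k - rem) · 2^s / 2^k` for
`r = n · 2^s / 2^k ≤ maxScaled`, `rem = n mod 2^k`. [folklore] -/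
theorem abs_sub_rneGrid_of_pattern {n k s : ℕ} (hlo : 2 ^ (φ.manBits + k) ≤ n)
    (hhi : n < 2 ^ (φ.manBits + k + 1)) (hle : (n : ℚ) * 2 ^ s / 2 ^ k ≤ φ.maxScaled) :
    |(n : ℚ) * 2 ^ s / 2 ^ k - (φ.rneGrid ((n : ℚ) * 2 ^ s / 2 ^ k) : ℚ)|
      = ((min (n % 2 ^ k) (2 ^ k - n % 2 ^ k) : ℕ) : ℚ) * 2 ^ s / 2 ^ k := by
  have h2s : (0 : ℚ) < 2 ^ s := by positivity
  rw [rneGrid_of_pattern hlo hhi hle,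
    show (n : ℚ) * 2 ^ s / 2 ^ k - (rneInt ((n : ℚ) / 2 ^ k) : ℚ) * 2 ^ s
      = ((n : ℚ) / 2 ^ k - (rneInt ((n : ℚ) / 2 ^ k) : ℚ)) * 2 ^ s by ring,
    abs_mul, abs_of_pos h2s, abs_sub_rneInt_natCast_div_two_pow]
  ring

/-- ROUND-DOWN OF A PATTERN on the grid: `rdGrid (n · 2^s / 2^k) = (n / 2^k)_ℕ · 2^s` — truncate
the pattern to `P` bits, then scale. [folklore] -/
theorem rdGrid_of_pattern {n k s : ℕ} (hlo : 2 ^ (φ.manBits + k) ≤ n)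
    (hhi : n < 2 ^ (φ.manBits + k + 1)) (hle : (n : ℚ) * 2 ^ s / 2 ^ k ≤ φ.maxScaled) :
    φ.rdGrid ((n : ℚ) * 2 ^ s / 2 ^ k) = n / 2 ^ k * 2 ^ s := by
  have hr : (0 : ℚ) ≤ (n : ℚ) * 2 ^ s / 2 ^ k := by positivity
  rw [rdGrid_eq_floor_mul hr hle, shift_floor_of_pattern hlo hhi hle, pattern_div_two_pow,
    floor_natCast_div_two_pow, Int.toNat_natCast]

/-- TOWARD ZERO, SIGNIFICAND LEVEL (grid): `r - rdGrid r = rem · 2^s / 2^k`. [folklore] -/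
theorem sub_rdGrid_of_pattern {n k s : ℕ} (hlo : 2 ^ (φ.manBits + k) ≤ n)
    (hhi : n < 2 ^ (φ.manBits + k + 1)) (hle : (n : ℚ) * 2 ^ s / 2 ^ k ≤ φ.maxScaled) :
    (n : ℚ) * 2 ^ s / 2 ^ k - (φ.rdGrid ((n : ℚ) * 2 ^ s / 2 ^ k) : ℚ)
      = ((n % 2 ^ k : ℕ) : ℚ) * 2 ^ s / 2 ^ k := by
  have hdec := natCast_div_two_pow n k
  have e : (n : ℚ) * 2 ^ s / 2 ^ k = (n : ℚ) / 2 ^ k * 2 ^ s := by ring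
  rw [rdGrid_of_pattern hlo hhi hle, e, hdec]
  push_cast
  ring

/-- ROUND-UP OF A PATTERN on the grid: `ruGrid (n · 2^s / 2^k) = ⌈n / 2^k⌉ · 2^s =
((n / 2^k)_ℕ + [rem ≠ 0]) · 2^s`. [folklore] -/
theorem ruGrid_of_pattern {n k s : ℕ} (hlo : 2 ^ (φ.manBits + k) ≤ n)
    (hhi : n < 2 ^ (φ.manBits + k + 1)) (hle : (n : ℚ) * 2 ^ s / 2 ^ k ≤ φ.maxScaled) :
    φ.ruGrid ((n : ℚ) * 2 ^ s / 2 ^ k) = (n / 2 ^ k + if n % 2 ^ k = 0 then 0 else 1) * 2 ^ s := by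
  unfold ruGrid
  rw [if_pos hle, shift_floor_of_pattern hlo hhi hle, pattern_div_two_pow,
    ceil_natCast_div_two_pow]
  split_ifs <;> congr 1

/-- AWAY FROM ZERO, SIGNIFICAND LEVEL (grid): `ruGrid r - r = (2^k - rem) · 2^s / 2^k`, or `0` when
`rem = 0`. [folklore] -/
theorem ruGrid_sub_of_pattern {n k s : ℕ} (hlo : 2 ^ (φ.manBits + k) ≤ n)
    (hhi : n < 2 ^ (φ.manBits + k + 1)) (hle : (n : ℚ) * 2 ^ s / 2 ^ k ≤ φ.maxScaled) :
    (φ.ruGrid ((n : ℚ) * 2 ^ s / 2 ^ k) : ℚ) - (n : ℚ) * 2 ^ s / 2 ^ k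
      = ((if n % 2 ^ k = 0 then 0 else 2 ^ k - n % 2 ^ k : ℕ) : ℚ) * 2 ^ s / 2 ^ k := by
  have hρ : n % 2 ^ k < 2 ^ k := Nat.mod_lt n (Nat.two_pow_pos k)
  have hdec := natCast_div_two_pow n k
  have e : (n : ℚ) * 2 ^ s / 2 ^ k = (n : ℚ) / 2 ^ k * 2 ^ s := by ring
  rw [ruGrid_of_pattern hlo hhi hle, e, hdec]
  split_ifs with h0
  · rw [h0]; push_cast; ring
  · push_cast [Nat.cast_sub hρ.le]; field_simp; ring

end Format

end Literature.ComputerArithmetic.FloatingPoint
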